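import Summits.AtomisticToContinuum.BoseEinsteinCondensation.Theorems.BECCutLineWeakDisorderWitnessTransfer
import Summits.AtomisticToContinuum.BoseEinsteinCondensation.Theorems.BECCutLineWeakDisorderLateCoreSplitDefs
import Summits.AtomisticToContinuum.BoseEinsteinCondensation.Theorems.BECCutLineWeakDisorderLateCoreSplitGlueLate
import HarnessLib

/-!
# Route `BECCutLineWeakDisorder`, crux `TwoReplicaTransienceBound` (stmt-AtomisticToContinuum-9687), line
# `late-core-split`: the registered stub `stub_lateWitnessTransfer : LateTwoReplicaBound → LandscapeBound`

Support file (`--supports stmt-AtomisticToContinuum-9687`; lead c7 adopting the crux strategist's line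
`Cruxes/TwoReplicaTransienceBound/Lines/late_core_split.lean`, census `…/STRATEGY-CENSUS.md`).

* `landscape_of_late_at` — the bookkeeping of `CutLineWitness.stub_landscape_of_parts` /
  `Theorems.WitnessTransfer_of` re-run with the LATE two-replica clause (`∀ᶠ T in atTop`, unpacked by
  `Filter.eventually_atTop` into a threshold `T₀`), the late glue `stub_glueLandscapeAtLate`
  (`…LateCoreSplitGlueLate.lean`, `T₁ = max T₀ 1`) and the landed parts (B) `stub_heig`, (C)
  `stub_envelope`, (E1a) `stub_formBound`, (E1b) `stub_trialState`, (F) `stub_ratio_mollify`, (E2)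
  `stub_vanish` of crux `WitnessTransfer` (stmt-14978, closed); `ρ₀ ↦ min ρ₀ ρ'₀`, `C ↦ C + 1`.
* `stub_lateWitnessTransfer : Goal.stub_lateWitnessTransfer` — the registered stub.

Consequence (with the sorry-free `landscapeBound_of_late` of `…LateCoreSplitDefs.lean`): the route's
hinge `LandscapeBound` follows from `WitnessZeroMode ∧ OverlapNoIntermittency` alone — the
intermediate-polymer-length regime of the crux (`NoTransientOvershoot`, the `∀ T ≥ 1` excess of the
parent statement) leaves the route's critical path (strategist census §D; LeadC7Report §4).
-/

noncomputable section

open MeasureTheory Filter Set Metric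
open scoped ENNReal NNReal Topology

namespace Summit.AtomisticToContinuum.BoseEinsteinCondensation.Cruxes.TwoReplicaTransienceBound.LateCoreSplit

open Literature.MathematicalPhysics.QuantumManyBody.BoseGas
open Summit.AtomisticToContinuum.BoseEinsteinCondensation.Theses.BECCutLineWeakDisorder
open Summit.AtomisticToContinuum.BoseEinsteinCondensation.Theorems.CutLineWitness

/-- **The landscape clause at `v` from the LATE two-replica clause at `v`** (`ρ₀ ↦ min ρ₀ ρ'₀`,
`C ↦ C + 1`): at each eventual `n` (finite `E₀`, `glue_eventually_groundStateEnergy_ne_top`) unpack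
`∀ᶠ T` into a threshold `T₀` and run `stub_glueLandscapeAtLate` with `T₁ = max T₀ 1` and the landed
parts (B), (C), (E1a), (E1b), (F), (E2). [folklore] -/
theorem landscape_of_late_at (v : ℝ → ℝ≥0∞) (hv : IsRepulsiveFiniteRange v)
    (hL : ∃ ρ₀ : ℝ, 0 < ρ₀ ∧ ∀ ρ : ℝ, 0 < ρ → ρ < ρ₀ → ∃ C : ℝ, 0 < C ∧
      ∀ᶠ n : ℕ in atTop, ∀ᶠ T : ℝ in atTop, overlap v ρ n T ≤ ENNReal.ofReal C) :
    ∃ ρ₀ : ℝ, 0 < ρ₀ ∧ ∀ ρ : ℝ, 0 < ρ → ρ < ρ₀ → ∃ C : ℝ, 0 < C ∧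
      ∀ᶠ n : ℕ in Filter.atTop, ∀ δ : ℝ≥0∞, 0 < δ →
        ∃ Ψ : TrialState (n + 1) (sideLength ρ (n + 1)),
          energy v Ψ ≤ groundStateEnergy v (n + 1) (sideLength ρ (n + 1)) + δ ∧
          (∀ X, Ψ.ψ X = (‖Ψ.ψ X‖ : ℂ)) ∧
          ∫⁻ Y : Config n, ENNReal.ofReal (sideLength ρ (n + 1) ^ 3) *
            (∫⁻ x, (‖Ψ.ψ (Matrix.vecCons x Y)‖₊ : ℝ≥0∞) ^ 2) ^ 2 /
              (∫⁻ x, (‖Ψ.ψ (Matrix.vecCons x Y)‖₊ : ℝ≥0∞)) ^ 2 ≤ ENNReal.ofReal C := by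
  obtain ⟨ρ₁, hρ₁, H1⟩ := hL
  obtain ⟨ρ₂, hρ₂, H2⟩ := glue_eventually_groundStateEnergy_ne_top v hv
  refine ⟨min ρ₁ ρ₂, lt_min hρ₁ hρ₂, fun ρ hρ hρlt => ?_⟩
  obtain ⟨C, hC, hevC⟩ := H1 ρ hρ (hρlt.trans_le (min_le_left _ _))
  refine ⟨C + 1, by linarith, ?_⟩
  filter_upwards [hevC, H2 ρ hρ (hρlt.trans_le (min_le_right _ _))] with n hlate hEfin
  intro δ hδ
  obtain ⟨T₀, hT₀⟩ := Filter.eventually_atTop.1 hlate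
  have hrat : ∀ T : ℝ, max T₀ 1 ≤ T →
      ∫⁻ Y : Config n, ENNReal.ofReal (sideLength ρ (n + 1) ^ 3) *
        (∫⁻ x, (‖fkWitness (N := n + 1) v (sideLength ρ (n + 1)) T (fun _ => (1 : ℝ≥0∞))
          (Matrix.vecCons x Y)‖₊ : ℝ≥0∞) ^ 2) ^ 2 /
        (∫⁻ x, (‖fkWitness (N := n + 1) v (sideLength ρ (n + 1)) T (fun _ => (1 : ℝ≥0∞))
          (Matrix.vecCons x Y)‖₊ : ℝ≥0∞)) ^ 2 ≤ ENNReal.ofReal C :=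
    fun T hT => hT₀ T ((le_max_left _ _).trans hT)
  exact stub_glueLandscapeAtLate (fun hv L _ hT h0 _ ht => stub_heig hv L hT h0 ht)
    (fun hv _ hL hN hE => stub_envelope hv hL hN hE)
    (fun hv _ hL _ hΨm _ hM hnn h0 hnorm _ heig => stub_formBound hv hL hΨm hM hnn h0 hnorm heig)
    (fun hv _ hL _ hfm _ hM hnn hsymm hpos _ hSm hSbox _ hr₀ hmargin hSV _ hK hev _ hε =>
      stub_trialState hv hL hfm hM hnn hsymm hpos hSm hSbox hr₀ hmargin hSV hK hev hε)
    (fun hfm _ hM hnn _ hr₀ h0 _ hε => stub_ratio_mollify hfm hM hnn hr₀ h0 hε)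
    hv (fun L _ hT _ hη => stub_vanish hv L hT hη)
    (sideLength_pos_of_pos hρ (Nat.succ_pos n)) hEfin hC.le (le_max_right _ _) hrat hδ

/-- **Registered stub `stub_lateWitnessTransfer` of line `late-core-split`**: the LATE-time
two-replica bound already yields the route's hinge `LandscapeBound`. -/
theorem stub_lateWitnessTransfer : Goal.stub_lateWitnessTransfer :=
  fun hLate v hv => landscape_of_late_at v hv (hLate v hv)

/-- Hence the hinge from the two late-time conjecture inputs and nothing else (the registered
composition `landscapeBound_of_late` with its provable third hypothesis discharged). -/
theorem landscapeBound_of_zeroMode_noIntermittency (hZ : WitnessZeroMode)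
    (hA : OverlapNoIntermittency) : LandscapeBound :=
  landscapeBound_of_late hZ hA stub_lateWitnessTransfer

end Summit.AtomisticToContinuum.BoseEinsteinCondensation.Cruxes.TwoReplicaTransienceBound.LateCoreSplit

end
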